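import Summits.AtomisticToContinuum.Crystallization.Theses.ChessboardParticlePlanes
import Summits.AtomisticToContinuum.Crystallization.Theses.LaminarSixThreeThree
import Summits.AtomisticToContinuum.Crystallization.Theorems.PhononSlackCertificatesPeriodicGivenLayered
import Summits.AtomisticToContinuum.Crystallization.Theorems.LaminarSixThreeThreeBarlowToHcpWindows
import Literature.MathematicalPhysics.StatisticalMechanics.BarlowStackingEnergy
import Summits.AtomisticToContinuum.Crystallization.Theorems.ChessboardParticlePlanesPeriodicWindowsHcpTrialEnergy
import Summits.AtomisticToContinuum.Crystallization.Theorems.ChessboardParticlePlanesPeriodicWindowsBarlowHullPoint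
import Summits.AtomisticToContinuum.Crystallization.Theorems.ChessboardParticlePlanesPeriodicWindowsSiteEnvelope
import Summits.AtomisticToContinuum.Crystallization.Theorems.ChessboardParticlePlanesPeriodicWindowsShapeStationarity
import Summits.AtomisticToContinuum.Crystallization.Theorems.ChessboardParticlePlanesPeriodicWindowsEnvelopeNumerics

/-!
# Crux `PeriodicWindows` (stmt-AtomisticToContinuum-3240), line `Sketch` — the bridges `LaminarBarlowWindows ⇒ PeriodicWindows / LayeredWindows`

Sorry-free extract of the lead skeleton rev 9 (`Cruxes/PeriodicWindows/Lines/Sketch.lean`, lead prover-line-stmt-AtomisticToContinuum-3240-c3-0):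
every stub of the line except its INPUT S0 (= board item stmt-14292 `LaminarSixThreeThree.LaminarBarlowWindows`) is landed
(E1 `stub_barlowHullPoint`, E2a `stub_shapeStationarity`, E2m `stub_siteEnvelope`, E2b `stub_envelopeNumerics`, E2c `stub_hcpTrialEnergy`),
so the composition is a genuine theorem CONDITIONAL on that board item only:

* `periodicWindows_of_barlowWindows` — for ONE sequence of Lennard-Jones ground states: if at every scale, frequently in `N`, one particle has an
  `(R, ε)`-window matched after a rigid motion to SOME `barlowStacking a h s` (`a, h ∈ (1/2, 2)`, any Hägg word), then the `PeriodicWindows`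
  clause holds for that sequence (one Barlow stacking in the hull by compactness; its shape and scale pinned by scaling stationarity + certified
  lattice sums; then the landed stacking selection `LayeredHull.PeriodicGivenLayered_of`, item 11779);
* `layeredWindows_of_barlowWindows` — the same hypothesis gives the `LayeredWindows` data (route `HullMinimality`, item 11778) for that sequence;
* `PeriodicWindows_of_laminarBarlowWindows : LaminarBarlowWindows → PeriodicWindows` (14292 ⇒ 3240, without `StackingFaultSparsity` 14296);
* `LayeredWindows_of_laminarBarlowWindows : LaminarBarlowWindows → HullMinimality.LayeredWindows` (14292 ⇒ 11778).

All `[folklore]` bookkeeping over the landed stubs; `--supports stmt-AtomisticToContinuum-3240`.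
-/

noncomputable section

namespace Summit.AtomisticToContinuum.Crystallization.Theorems.PeriodicWindowsSketch

open Literature.MathematicalPhysics.StatisticalMechanics Filter Metric
open Summit.AtomisticToContinuum.Crystallization.Theses.ChessboardParticlePlanes (PeriodicWindows)

/-! ## G1 — one Barlow window per scale, frequently in `N` -/

/-- G1 (glue, proved): a.e. Barlow windows (S0) give, for every `R > 0`, `ε ∈ (0, 1/4)` and every
ground-state sequence, frequently (indeed eventually) in `N` a particle with an `(R, ε)`-Barlow window
(counting: `eventually_exists_of_card_div_tendsto_zero` with both predicates equal). -/
theorem barlowWindow_frequently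
    (hS0 : ∀ R ε : ℝ, 0 < R → 0 < ε → ε < 1 / 4 → ∀ x : (N : ℕ) → (Fin N → EuclideanSpace ℝ (Fin 3)),
      (∀ N, IsGroundState lennardJones (x N)) →
      Filter.Tendsto (fun N : ℕ => (Nat.card {i : Fin N // ¬ (∃ a h : ℝ, 1 / 2 < a ∧ a < 2 ∧
        1 / 2 < h ∧ h < 2 ∧ ∃ s : ℤ → ℤ, IsHaggSeq s ∧ ∃ z ∈ barlowStacking a h s,
        ∃ A : EuclideanSpace ℝ (Fin 3) →ₗᵢ[ℝ] EuclideanSpace ℝ (Fin 3),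
          (∀ p ∈ barlowStacking a h s, dist p z ≤ R → ∃ j : Fin N, dist (x N j) (x N i + A (p - z)) ≤ ε) ∧
          (∀ j : Fin N, dist (x N j) (x N i) ≤ R →
            ∃ p ∈ barlowStacking a h s, dist (x N j) (x N i + A (p - z)) ≤ ε))} : ℝ) / N)
        Filter.atTop (nhds 0))
    (x : (N : ℕ) → (Fin N → EuclideanSpace ℝ (Fin 3))) (hx : ∀ N, IsGroundState lennardJones (x N)) :
    ∀ R ε : ℝ, 0 < R → 0 < ε → ε < 1 / 4 → ∃ᶠ N in Filter.atTop, ∃ (i : Fin N) (a h : ℝ),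
      1 / 2 < a ∧ a < 2 ∧ 1 / 2 < h ∧ h < 2 ∧ ∃ s : ℤ → ℤ, IsHaggSeq s ∧ ∃ z ∈ barlowStacking a h s,
        ∃ A : EuclideanSpace ℝ (Fin 3) →ₗᵢ[ℝ] EuclideanSpace ℝ (Fin 3),
          (∀ p ∈ barlowStacking a h s, dist p z ≤ R → ∃ j : Fin N, dist (x N j) (x N i + A (p - z)) ≤ ε) ∧
          (∀ j : Fin N, dist (x N j) (x N i) ≤ R →
            ∃ p ∈ barlowStacking a h s, dist (x N j) (x N i + A (p - z)) ≤ ε) := by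
  intro R ε hR hε hε4
  have hP := hS0 R ε hR hε hε4 x hx
  have hev := eventually_exists_of_card_div_tendsto_zero (Q := fun N i => ∃ a h : ℝ, 1 / 2 < a ∧ a < 2 ∧
        1 / 2 < h ∧ h < 2 ∧ ∃ s : ℤ → ℤ, IsHaggSeq s ∧ ∃ z ∈ barlowStacking a h s,
        ∃ A : EuclideanSpace ℝ (Fin 3) →ₗᵢ[ℝ] EuclideanSpace ℝ (Fin 3),
          (∀ p ∈ barlowStacking a h s, dist p z ≤ R → ∃ j : Fin N, dist (x N j) (x N i + A (p - z)) ≤ ε) ∧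
          (∀ j : Fin N, dist (x N j) (x N i) ≤ R →
            ∃ p ∈ barlowStacking a h s, dist (x N j) (x N i + A (p - z)) ≤ ε)) hP (by
      have h0 : ∀ N : ℕ, (Nat.card {i : Fin N // (∃ a h : ℝ, 1 / 2 < a ∧ a < 2 ∧
        1 / 2 < h ∧ h < 2 ∧ ∃ s : ℤ → ℤ, IsHaggSeq s ∧ ∃ z ∈ barlowStacking a h s,
        ∃ A : EuclideanSpace ℝ (Fin 3) →ₗᵢ[ℝ] EuclideanSpace ℝ (Fin 3),
          (∀ p ∈ barlowStacking a h s, dist p z ≤ R → ∃ j : Fin N, dist (x N j) (x N i + A (p - z)) ≤ ε) ∧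
          (∀ j : Fin N, dist (x N j) (x N i) ≤ R →
            ∃ p ∈ barlowStacking a h s, dist (x N j) (x N i + A (p - z)) ≤ ε)) ∧
        ¬ (∃ a h : ℝ, 1 / 2 < a ∧ a < 2 ∧
        1 / 2 < h ∧ h < 2 ∧ ∃ s : ℤ → ℤ, IsHaggSeq s ∧ ∃ z ∈ barlowStacking a h s,
        ∃ A : EuclideanSpace ℝ (Fin 3) →ₗᵢ[ℝ] EuclideanSpace ℝ (Fin 3),
          (∀ p ∈ barlowStacking a h s, dist p z ≤ R → ∃ j : Fin N, dist (x N j) (x N i + A (p - z)) ≤ ε) ∧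
          (∀ j : Fin N, dist (x N j) (x N i) ≤ R →
            ∃ p ∈ barlowStacking a h s, dist (x N j) (x N i + A (p - z)) ≤ ε))} : ℝ) / N = 0 := by
        intro N
        have : IsEmpty {i : Fin N // (∃ a h : ℝ, 1 / 2 < a ∧ a < 2 ∧
          1 / 2 < h ∧ h < 2 ∧ ∃ s : ℤ → ℤ, IsHaggSeq s ∧ ∃ z ∈ barlowStacking a h s,
          ∃ A : EuclideanSpace ℝ (Fin 3) →ₗᵢ[ℝ] EuclideanSpace ℝ (Fin 3),
            (∀ p ∈ barlowStacking a h s, dist p z ≤ R → ∃ j : Fin N, dist (x N j) (x N i + A (p - z)) ≤ ε) ∧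
            (∀ j : Fin N, dist (x N j) (x N i) ≤ R →
              ∃ p ∈ barlowStacking a h s, dist (x N j) (x N i + A (p - z)) ≤ ε)) ∧
          ¬ (∃ a h : ℝ, 1 / 2 < a ∧ a < 2 ∧
          1 / 2 < h ∧ h < 2 ∧ ∃ s : ℤ → ℤ, IsHaggSeq s ∧ ∃ z ∈ barlowStacking a h s,
          ∃ A : EuclideanSpace ℝ (Fin 3) →ₗᵢ[ℝ] EuclideanSpace ℝ (Fin 3),
            (∀ p ∈ barlowStacking a h s, dist p z ≤ R → ∃ j : Fin N, dist (x N j) (x N i + A (p - z)) ≤ ε) ∧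
            (∀ j : Fin N, dist (x N j) (x N i) ≤ R →
              ∃ p ∈ barlowStacking a h s, dist (x N j) (x N i + A (p - z)) ≤ ε))} :=
          ⟨fun ⟨_, h1, h2⟩ => h2 h1⟩
        rw [Nat.card_of_isEmpty]
        simp
      simp_rw [h0]
      exact tendsto_const_nhds)
  exact hev.frequently.mono fun N ⟨i, hi⟩ => ⟨i, hi⟩

/-! ## E1/E2 — the landed stubs `stub_barlowHullPoint`, `stub_shapeStationarity`, `stub_siteEnvelope`, `stub_envelopeNumerics`, `stub_hcpTrialEnergy` are imported -/

/-! STUB E1 `stub_barlowHullPoint` is LANDED: p130256,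
`Theorems/ChessboardParticlePlanesPeriodicWindowsBarlowHullPoint.lean` (imported above). -/

/-! ## E2 — pinning the shape and the scale of a Barlow hull point

Notation (all in tree vocabulary, `BarlowStackingEnergy.lean`): for `n = 3, 6` let `Vₙ r = (r²)⁻ⁿ`, so that
`V_LJ = V₆/12 - V₃/6`; the SITE SHAPE SUMS of the stacking of shape `c = h/a` (unit in-layer spacing) are
`σₙ(m) = barlowSiteEnergy Vₙ 1 c s m = ½ ∑_{y ≠ x} |x - y|^{-2n}` (`x` in layer `m`); the word-free pieces are
`e₀(n, c) = barlowBaseEnergy Vₙ 1 c` and the couplings `Jₙ(c, k) = barlowCoupling Vₙ 1 c k` (aligned minus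
shifted layer sum at layer distance `k`), with `σₙ(m) = e₀ + ½ ∑_{k ≥ 2} Jₙ(k) (1[m, m+k aligned] + 1[m-k, m
aligned])` (`barlowSiteEnergy_eq`). -/

/-! STUB E2a `stub_shapeStationarity` is LANDED: p131146,
`Theorems/ChessboardParticlePlanesPeriodicWindowsShapeStationarity.lean` (+ helpers `…ShapeStationarity1…6.lean`; imported above). -/

/-! STUB E2m `stub_siteEnvelope` is LANDED: p130480,
`Theorems/ChessboardParticlePlanesPeriodicWindowsSiteEnvelope.lean` (imported above). -/

/-! STUB E2c `stub_hcpTrialEnergy` is LANDED: p129941,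
`Theorems/ChessboardParticlePlanesPeriodicWindowsHcpTrialEnergy.lean` (imported above). -/

/-! ## E2 glue: the four E2 stubs pin `(a, h)` into the box of `PeriodicGivenLayered` -/

/-- E2 GLUE (proved, pure algebra over the four E2 stubs): a rotated exact Barlow stacking with
`a, h ∈ [1/2, 2]` in the hull of a ground-state sequence has `47/50 ≤ a ≤ 1` and `39a/50 ≤ h ≤ 17a/20`.
Off the shape box the envelopes and the numerics bound `σ₃(m)² ≤ 8.6 σ₆(m)` at EVERY site, while
stationarity and the hcp trial value give a site with `σ₃² ≥ (8.60988 - η) σ₆` — contradiction; on the box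
the mediant bounds `a⁶ ∈ [inf σ₆/σ₃, sup σ₆/σ₃] ⊆ [(47/50)⁶, 1]`. -/
theorem box_of_shape (x : (N : ℕ) → (Fin N → EuclideanSpace ℝ (Fin 3)))
    (hx : ∀ N, IsGroundState lennardJones (x N)) (a h : ℝ) (ha1 : 1 / 2 ≤ a) (ha2 : a ≤ 2)
    (hh1 : 1 / 2 ≤ h) (hh2 : h ≤ 2) (s : ℤ → ℤ) (hs : IsHaggSeq s)
    (A : EuclideanSpace ℝ (Fin 3) →ₗᵢ[ℝ] EuclideanSpace ℝ (Fin 3))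
    (hH : ∀ R ε : ℝ, 0 < ε → ∃ᶠ N in Filter.atTop, ∃ t : EuclideanSpace ℝ (Fin 3),
        (∀ p ∈ A '' barlowStacking a h s, ‖p‖ ≤ R → ∃ i : Fin N, dist (x N i + t) p ≤ ε) ∧
        (∀ i : Fin N, ‖x N i + t‖ ≤ R → ∃ p ∈ A '' barlowStacking a h s, dist (x N i + t) p ≤ ε)) :
    47 / 50 ≤ a ∧ a ≤ 1 ∧ 39 / 50 * a ≤ h ∧ h ≤ 17 / 20 * a := by
  have ha : 0 < a := by linarith
  have hh : 0 < h := by linarith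
  set c := h / a with hc_def
  have hc0 : 0 < c := div_pos hh ha
  have hhc : h = c * a := by rw [hc_def]; field_simp
  have hc14 : 1 / 4 ≤ c := by
    rw [hc_def, le_div_iff₀ ha]; linarith
  have hc4 : c ≤ 4 := by
    rw [hc_def, div_le_iff₀ ha]; linarith
  obtain ⟨hst1, hst2, hst3⟩ := stub_shapeStationarity x hx a h ha hh s hs A hH
  obtain ⟨hnum1, hnum2⟩ := stub_envelopeNumerics
  obtain ⟨a₁, h₁, ha₁, hh₁, he₁⟩ := stub_hcpTrialEnergy
  -- abbreviations
  set σ3 : ℤ → ℝ := fun m => barlowSiteEnergy (fun r => (r ^ 2)⁻¹ ^ 3) 1 c s m with hσ3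
  set σ6 : ℤ → ℝ := fun m => barlowSiteEnergy (fun r => (r ^ 2)⁻¹ ^ 6) 1 c s m with hσ6
  set E3 : ℝ := barlowBaseEnergy (fun r => (r ^ 2)⁻¹ ^ 3) 1 c with hE3
  set E6 : ℝ := barlowBaseEnergy (fun r => (r ^ 2)⁻¹ ^ 6) 1 c with hE6
  set J3 : ℝ := barlowCoupling (fun r => (r ^ 2)⁻¹ ^ 3) 1 c 2 with hJ3
  set J6 : ℝ := barlowCoupling (fun r => (r ^ 2)⁻¹ ^ 6) 1 c 2 with hJ6
  set T3 : ℝ := ∑' k : ℕ, barlowCoupling (fun r => (r ^ 2)⁻¹ ^ 3) 1 c (k + 3) with hT3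
  set T6 : ℝ := ∑' k : ℕ, barlowCoupling (fun r => (r ^ 2)⁻¹ ^ 6) 1 c (k + 3) with hT6
  -- Step 1: the shape is in the box `39/50 < c < 17/20`
  have hcbox : 39 / 50 < c ∧ c < 17 / 20 := by
    by_contra hcon
    have hoff : (1 / 4 ≤ c ∧ c ≤ 39 / 50) ∨ (17 / 20 ≤ c ∧ c ≤ 4) := by
      rcases not_and_or.1 hcon with h1 | h1
      · exact Or.inl ⟨hc14, not_lt.1 h1⟩
      · exact Or.inr ⟨not_lt.1 h1, hc4⟩
    obtain ⟨m, hm⟩ := hst1 (hcpPeriodicConfiguration ha₁ hh₁) (1 / 1000) (by norm_num)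
    obtain ⟨p, q, hp, hq, ⟨hL3, hU3⟩, ⟨hL6, hU6⟩, hE3pos, hE6pos, hJ3nn, hJ6nn⟩ :=
      stub_siteEnvelope c hc0 s hs m
    have hnum := hnum1 c p q hoff hp hq
    have hpq : 0 ≤ p + q := by rcases hp with rfl | rfl <;> rcases hq with rfl | rfl <;> norm_num
    -- positivity of the site sums
    have hσ3pos : 0 < σ3 m := by
      have : 0 < 2 * E3 + (p + q) * J3 := by positivity
      simp only [hσ3]; linarith
    have hσ6pos : 0 < σ6 m := by
      have : 0 < 2 * E6 + (p + q) * J6 := by positivity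
      simp only [hσ6]; linarith
    -- upper bound at the site from the envelope and the numerics: σ3² ≤ 8.6 σ6
    have hup : (σ3 m) ^ 2 ≤ (43 / 5) * σ6 m := by
      have h1 : (2 * σ3 m) ^ 2 ≤ (2 * E3 + (p + q) * J3 + 2 * T3) ^ 2 := by
        have h0 : 0 ≤ 2 * σ3 m := by linarith
        exact pow_le_pow_left₀ h0 hU3 2
      have h2 : (2 * E3 + (p + q) * J3 + 2 * T3) ^ 2 ≤ (86 / 5) * (2 * E6 + (p + q) * J6) := hnum
      nlinarith
    -- lower bound at the site from stationarity and the hcp trial value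
    have hlow : (-(12 * (hcpPeriodicConfiguration ha₁ hh₁).energyPerParticle lennardJones) - 1 / 1000) *
        σ6 m ≤ (σ3 m) ^ 2 := hm
    have hcoef : (43 / 5 : ℝ) < -(12 * (hcpPeriodicConfiguration ha₁ hh₁).energyPerParticle lennardJones) -
        1 / 1000 := by linarith
    have : (43 / 5 : ℝ) * σ6 m < (-(12 * (hcpPeriodicConfiguration ha₁ hh₁).energyPerParticle lennardJones) -
        1 / 1000) * σ6 m := mul_lt_mul_of_pos_right hcoef hσ6pos
    linarith
  -- Step 2: the scale `a` is in `[47/50, 1]`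
  have ha6lo : (47 / 50 : ℝ) ^ 6 ≤ a ^ 6 := by
    refine le_of_forall_pos_le_add fun η hη => ?_
    obtain ⟨m, hm⟩ := hst2 η hη
    obtain ⟨p, q, hp, hq, ⟨hL3, hU3⟩, ⟨hL6, hU6⟩, hE3pos, hE6pos, hJ3nn, hJ6nn⟩ :=
      stub_siteEnvelope c hc0 s hs m
    obtain ⟨hn1, -⟩ := hnum2 c p q hcbox.1.le hcbox.2.le hp hq
    have hpq : 0 ≤ p + q := by rcases hp with rfl | rfl <;> rcases hq with rfl | rfl <;> norm_num
    have hU3pos : 0 < 2 * E3 + (p + q) * J3 + 2 * T3 := by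
      have : 0 < 2 * E3 + (p + q) * J3 := by positivity
      linarith
    -- (47/50)^6 U3 ≤ L6 ≤ 2 σ6 ≤ 2 (a⁶+η) σ3 ≤ (a⁶+η) U3
    have hσ3pos : 0 < σ3 m := by
      have : 0 < 2 * E3 + (p + q) * J3 := by positivity
      simp only [hσ3]; linarith
    have haη : 0 < a ^ 6 + η := by positivity
    have h1 : (47 / 50 : ℝ) ^ 6 * (2 * E3 + (p + q) * J3 + 2 * T3) ≤ (a ^ 6 + η) * (2 * E3 + (p + q) * J3 + 2 * T3) := by
      calc (47 / 50 : ℝ) ^ 6 * (2 * E3 + (p + q) * J3 + 2 * T3) ≤ 2 * E6 + (p + q) * J6 := hn1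
        _ ≤ 2 * σ6 m := hL6
        _ ≤ 2 * ((a ^ 6 + η) * σ3 m) := by linarith
        _ = (a ^ 6 + η) * (2 * σ3 m) := by ring
        _ ≤ (a ^ 6 + η) * (2 * E3 + (p + q) * J3 + 2 * T3) := mul_le_mul_of_nonneg_left hU3 haη.le
    have := le_of_mul_le_mul_right h1 hU3pos
    linarith
  have ha6hi : a ^ 6 ≤ 1 := by
    refine le_of_forall_pos_le_add fun η hη => ?_
    obtain ⟨m, hm⟩ := hst3 η hη
    obtain ⟨p, q, hp, hq, ⟨hL3, hU3⟩, ⟨hL6, hU6⟩, hE3pos, hE6pos, hJ3nn, hJ6nn⟩ :=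
      stub_siteEnvelope c hc0 s hs m
    obtain ⟨-, hn2⟩ := hnum2 c p q hcbox.1.le hcbox.2.le hp hq
    have hpq : 0 ≤ p + q := by rcases hp with rfl | rfl <;> rcases hq with rfl | rfl <;> norm_num
    have hσ3pos : 0 < σ3 m := by
      have : 0 < 2 * E3 + (p + q) * J3 := by positivity
      simp only [hσ3]; linarith
    -- 2 (a⁶-η) σ3 ≤ 2 σ6 ≤ U6 ≤ L3 ≤ 2 σ3
    have h1 : (a ^ 6 - η) * (2 * σ3 m) ≤ 1 * (2 * σ3 m) := by
      calc (a ^ 6 - η) * (2 * σ3 m) = 2 * ((a ^ 6 - η) * σ3 m) := by ring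
        _ ≤ 2 * σ6 m := by linarith
        _ ≤ 2 * E6 + (p + q) * J6 + 2 * T6 := hU6
        _ ≤ 2 * E3 + (p + q) * J3 := hn2
        _ ≤ 2 * σ3 m := hL3
        _ = 1 * (2 * σ3 m) := by ring
    have := le_of_mul_le_mul_right h1 (by linarith)
    linarith
  have ha47 : 47 / 50 ≤ a := le_of_pow_le_pow_left₀ (by norm_num) ha.le ha6lo
  have ha1' : a ≤ 1 := by
    have : a ^ 6 ≤ 1 ^ 6 := by simpa using ha6hi
    exact le_of_pow_le_pow_left₀ (by norm_num) zero_le_one this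
  refine ⟨ha47, ha1', ?_, ?_⟩
  · rw [hhc]; nlinarith [hcbox.1]
  · rw [hhc]; nlinarith [hcbox.2]

/-! ## E3 — a Barlow hull point with box parameters is a layered hull point; the bridges -/

/-- E3 (bookkeeping, proved): the rotated Barlow stacking is the layered set of `LayeredWindows` /
`PeriodicGivenLayered` with heights `z m = h m` (`barlowPos a h s m i j = i u + j v + L_s(m) w + m · (h e₃)` and
`h e₃ = h · layerNormal 1`). -/
theorem image_barlowStacking_eq_layered (a h : ℝ) (s : ℤ → ℤ)
    (A : EuclideanSpace ℝ (Fin 3) →ₗᵢ[ℝ] EuclideanSpace ℝ (Fin 3)) :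
    A '' barlowStacking a h s = {p | ∃ m i j : ℤ, p = A (((i : ℝ) • triangularVec₁ a) +
        ((j : ℝ) • triangularVec₂ a) + ((haggLabel s m : ℝ) • barlowOffset a) + ((h * m) • layerNormal 1))} := by
  have hnorm : ∀ m : ℤ, (m : ℝ) • layerNormal h = (h * m) • layerNormal 1 := by
    intro m
    ext i
    fin_cases i <;> (simp [layerNormal]; try ring)
  ext p
  simp only [Set.mem_image, mem_barlowStacking_iff, Set.mem_setOf_eq]
  constructor
  · rintro ⟨q, ⟨k, i, j, rfl⟩, rfl⟩
    exact ⟨k, i, j, by rw [barlowPos, hnorm]⟩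
  · rintro ⟨m, i, j, rfl⟩
    exact ⟨barlowPos a h s m i j, ⟨m, i, j, rfl⟩, by rw [barlowPos, hnorm]⟩

/-- **BRIDGE (proved modulo the E2 stubs): layered windows from ONE Barlow window per scale.** If, for every `R > 0`
and `ε ∈ (0, 1/4)`, frequently in `N`, some particle of the Lennard-Jones ground state `x N` has an `(R, ε)`-window
matched (after a rigid motion) to SOME Barlow stacking with `a, h ∈ (1/2, 2)`, then `x` has LAYERED WINDOWS in the sense
of `HullMinimality.LayeredWindows` / the hypothesis of `PeriodicGivenLayered`: one in-layer spacing `a ∈ [47/50, 1]` and,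
at every scale, frequently in `N`, a translate of `x N` two-way matched with a layered set of box increments (here: the
exact rotated Barlow stacking found in the hull by E1, pinned by E2, read as a layered set by E3). -/
theorem layeredWindows_of_barlowWindows (x : (N : ℕ) → (Fin N → EuclideanSpace ℝ (Fin 3)))
    (hx : ∀ N, IsGroundState lennardJones (x N))
    (hW : ∀ R ε : ℝ, 0 < R → 0 < ε → ε < 1 / 4 → ∃ᶠ N in Filter.atTop, ∃ (i : Fin N) (a h : ℝ),
      1 / 2 < a ∧ a < 2 ∧ 1 / 2 < h ∧ h < 2 ∧ ∃ s : ℤ → ℤ, IsHaggSeq s ∧ ∃ z ∈ barlowStacking a h s,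
        ∃ A : EuclideanSpace ℝ (Fin 3) →ₗᵢ[ℝ] EuclideanSpace ℝ (Fin 3),
          (∀ p ∈ barlowStacking a h s, dist p z ≤ R → ∃ j : Fin N, dist (x N j) (x N i + A (p - z)) ≤ ε) ∧
          (∀ j : Fin N, dist (x N j) (x N i) ≤ R →
            ∃ p ∈ barlowStacking a h s, dist (x N j) (x N i + A (p - z)) ≤ ε)) :
    ∃ a : ℝ, 47 / 50 ≤ a ∧ a ≤ 1 ∧ ∀ R ε : ℝ, 0 < ε → ∃ᶠ N in Filter.atTop,
      ∃ (A : EuclideanSpace ℝ (Fin 3) →ₗᵢ[ℝ] EuclideanSpace ℝ (Fin 3)) (t : EuclideanSpace ℝ (Fin 3)) (s : ℤ → ℤ)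
        (z : ℤ → ℝ), IsHaggSeq s ∧ (∀ m : ℤ, 39 / 50 * a ≤ z (m + 1) - z m ∧ z (m + 1) - z m ≤ 17 / 20 * a) ∧
        let S : Set (EuclideanSpace ℝ (Fin 3)) := {p | ∃ m i j : ℤ, p = A (((i : ℝ) • triangularVec₁ a) +
          ((j : ℝ) • triangularVec₂ a) + ((haggLabel s m : ℝ) • barlowOffset a) + (z m • layerNormal 1))};
        (∀ p ∈ S, ‖p‖ ≤ R → ∃ i : Fin N, dist (x N i + t) p ≤ ε) ∧
        (∀ i : Fin N, ‖x N i + t‖ ≤ R → ∃ p ∈ S, dist (x N i + t) p ≤ ε) := by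
  obtain ⟨a, h, s, A, ha1, ha2, hh1, hh2, hs, hH⟩ := stub_barlowHullPoint x hW
  obtain ⟨hb1, hb2, hb3, hb4⟩ := box_of_shape x hx a h ha1 ha2 hh1 hh2 s hs A hH
  refine ⟨a, hb1, hb2, fun R ε hε => ?_⟩
  refine (hH R ε hε).mono fun N hN => ?_
  obtain ⟨t, h1, h2⟩ := hN
  refine ⟨A, t, s, fun m => h * m, hs, fun m => ?_, ?_⟩
  · constructor
    · push_cast; nlinarith
    · push_cast; nlinarith
  · show (∀ p ∈ {p | ∃ m i j : ℤ, p = A (((i : ℝ) • triangularVec₁ a) +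
        ((j : ℝ) • triangularVec₂ a) + ((haggLabel s m : ℝ) • barlowOffset a) + ((h * m) • layerNormal 1))},
        ‖p‖ ≤ R → ∃ i : Fin N, dist (x N i + t) p ≤ ε) ∧
      (∀ i : Fin N, ‖x N i + t‖ ≤ R → ∃ p ∈ {p | ∃ m i j : ℤ, p = A (((i : ℝ) • triangularVec₁ a) +
        ((j : ℝ) • triangularVec₂ a) + ((haggLabel s m : ℝ) • barlowOffset a) + ((h * m) • layerNormal 1))},
        dist (x N i + t) p ≤ ε)
    rw [← image_barlowStacking_eq_layered]
    exact ⟨h1, h2⟩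

/-- **BRIDGE (proved modulo the E2 stubs): periodic windows from ONE Barlow window per scale** — the crux's clause for
`x` (`layeredWindows_of_barlowWindows` + the landed stacking selection `LayeredHull.PeriodicGivenLayered_of`). So
conjunct (ii) of crystallization for a ground-state sequence follows from finding, at every scale and infinitely often
in `N`, ONE window of ONE ground state that is `ε`-Barlow (any polytype, any parameters in `(1/2, 2)`): the energy
(scaling stationarity) pins the lattice, and the recurrence/registry argument of item 11779 removes the faults. -/
theorem periodicWindows_of_barlowWindows (x : (N : ℕ) → (Fin N → EuclideanSpace ℝ (Fin 3)))
    (hx : ∀ N, IsGroundState lennardJones (x N))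
    (hW : ∀ R ε : ℝ, 0 < R → 0 < ε → ε < 1 / 4 → ∃ᶠ N in Filter.atTop, ∃ (i : Fin N) (a h : ℝ),
      1 / 2 < a ∧ a < 2 ∧ 1 / 2 < h ∧ h < 2 ∧ ∃ s : ℤ → ℤ, IsHaggSeq s ∧ ∃ z ∈ barlowStacking a h s,
        ∃ A : EuclideanSpace ℝ (Fin 3) →ₗᵢ[ℝ] EuclideanSpace ℝ (Fin 3),
          (∀ p ∈ barlowStacking a h s, dist p z ≤ R → ∃ j : Fin N, dist (x N j) (x N i + A (p - z)) ≤ ε) ∧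
          (∀ j : Fin N, dist (x N j) (x N i) ≤ R →
            ∃ p ∈ barlowStacking a h s, dist (x N j) (x N i + A (p - z)) ≤ ε)) :
    ∃ P : PeriodicConfiguration 3, ∀ R ε : ℝ, 0 < ε → ∃ᶠ N in Filter.atTop, ∃ t : EuclideanSpace ℝ (Fin 3),
      (∀ q ∈ P.points, ‖q‖ ≤ R → ∃ i : Fin N, dist (x N i + t) q ≤ ε) ∧
      (∀ i : Fin N, ‖x N i + t‖ ≤ R → ∃ q ∈ P.points, dist (x N i + t) q ≤ ε) := by
  have hpgl := LayeredHull.PeriodicGivenLayered_of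
  unfold Summit.AtomisticToContinuum.Crystallization.Theses.PhononSlackCertificates.PeriodicGivenLayered at hpgl
  exact hpgl x hx (layeredWindows_of_barlowWindows x hx hW)

/-- **BRIDGE 14292 ⇒ 11778** (proved modulo the E2 stubs): route `LaminarSixThreeThree`'s target `LaminarBarlowWindows`
(item stmt-14292) implies route `HullMinimality`'s 3-D crux `LayeredWindows` (item stmt-11778). -/
theorem LayeredWindows_of_laminarBarlowWindows
    (hS0 : Summit.AtomisticToContinuum.Crystallization.Theses.LaminarSixThreeThree.LaminarBarlowWindows) :
    Summit.AtomisticToContinuum.Crystallization.Theses.HullMinimality.LayeredWindows := by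
  intro x hx
  exact layeredWindows_of_barlowWindows x hx (barlowWindow_frequently hS0 x hx)

/-- **BRIDGE 14292 ⇒ 3240** (proved modulo the E2 stubs): `LaminarBarlowWindows` (item stmt-14292) implies the crux
`PeriodicWindows` — without `StackingFaultSparsity` (item 14296). -/
theorem PeriodicWindows_of_laminarBarlowWindows
    (hS0 : Summit.AtomisticToContinuum.Crystallization.Theses.LaminarSixThreeThree.LaminarBarlowWindows) :
    PeriodicWindows := fun x hx =>
  periodicWindows_of_barlowWindows x hx (barlowWindow_frequently hS0 x hx)

end Summit.AtomisticToContinuum.Crystallization.Theorems.PeriodicWindowsSketch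

end
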